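import Literature.NumberTheory.EllipticCurves.Rank1Residual.Typed.X5DescentSelmerCore
import HarnessLib

/-!
# X5 (p = 2): the LEVEL-3 datum over the tree's Selmer groups (the lower-bound-only rows)

Support file for the BSD rank-≤ 1 residual programme, class X5 (`p = 2`), unit `b2b-bsdres-sha-1`
(gen 5). Everything here is proved; the only named fact entering is Gross–Zagier–Kolyvagin (`hGZK`).

The census (`SHA-CENSUS.md` §5) isolates two core curves (19074h1, 19074h2; `#Ш_an = 64`) as
LOWER-BOUND-ONLY: engines G and H both see the order-8 shadow (`Ш[4] ⊆ 2Ш`), so `ord₂ #Ш ≥ 6`, but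
no engine certifies the level-3 stabilisation `Ш[16] = Ш[8]`. This file TYPES exactly that missing
input over the tree's own Selmer groups, in the same currency as `X5DescentSelmerCore`:

* `card_torsionBy_eight_of_two_divisible_four` — `#A[8] = #A[2] · #A[4]` when `A[4] ⊆ 2A`
  (doubling maps `A[8]` onto `A[4]` with kernel `A[2]`); with `#Ш[2] = 4`, `#Ш[4] = 16`: `#Ш[8] = 64`;
* `X5.four_torsion_two_divisible_of_selmer_lift₄` — every 4-Selmer class lifts to an 8-Selmer class
  ⟹ `Ш[4] ⊆ 2Ш` (what engine H's NONEMPTY verdicts / engine G's `m = 0` exhibit on these rows);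
* `X5.stable_eight_of_selmer_modeS₈` — MODE S AT LEVELS 8 | 16: no `s ∈ Sel^(8)(E/ℚ)` with
  `4·π₈(s) ≠ 0` lies in `[2]_* Sel^(16)(E/ℚ)` ⟹ `Ш[16] = Ш[8]` — the one input no engine of the lane
  computes (a 16-descent, or the Cassels–Tate pairing on `Sel^(8) × Sel^(2)`);
* `X5.descentCertificateAt_of_level_three`, `X5.bsdp_two_of_selmer_level3` — the level-3 datum and
  `BSD(E, 2)` from: the 2-descent count, the two lifting statements, mode S at `8 | 16`, and
  `ord₂ #Ш_an = 6`, granted GZK.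

Nothing here is claimed for 19074h1/h2: the hypothesis `hS` of `X5.bsdp_two_of_selmer_level3` is
precisely what remains OPEN for them (typed `MissingUpperBoundAt` in the lane's vocabulary).

References: Silverman, *AEC* (2009), Thm. X.4.2; Cassels (1998), §1; Merriman–Siksek–Smart (1996), §4;
Stamminger (2005), Thm. 6.2.2.
-/

noncomputable section

open scoped Classical

open WeierstrassCurve Literature.NumberTheory.EllipticCurves

namespace Literature.NumberTheory.EllipticCurves.Rank1Residual.Typed

section Algebra

variable {A : Type*} [AddCommGroup A]

/-- **`#A[8] = #A[2] · #A[4]` when every element of `A[4]` is twice an element**: multiplication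
by `2` maps `A[8]` ONTO `A[4]` with kernel `A[2]`. [cite: MerrimanSiksekSmart1996, §4] [cite: SilvermanAEC2009, Thm X.4.2(a)] -/
theorem card_torsionBy_eight_of_two_divisible_four {n m : ℕ}
    (h2 : Nat.card (AddSubgroup.torsionBy A 2) = n) (h4 : Nat.card (AddSubgroup.torsionBy A 4) = m)
    (hdiv : ∀ y : A, 4 • y = 0 → ∃ x : A, 2 • x = y) :
    Nat.card (AddSubgroup.torsionBy A 8) = n * m := by
  -- the doubling map on `A[8]`
  let f : AddSubgroup.torsionBy A 8 →+ A := (nsmulAddMonoidHom 2).comp (AddSubgroup.torsionBy A 8).subtype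
  have hf : ∀ x : AddSubgroup.torsionBy A 8, f x = 2 • (x : A) := fun x => rfl
  have hmem8 : ∀ x : A, x ∈ AddSubgroup.torsionBy A 8 ↔ 8 • x = 0 := fun x =>
    AddSubgroup.torsionBy.nsmul_iff (n := 8)
  have hmem4 : ∀ x : A, x ∈ AddSubgroup.torsionBy A 4 ↔ 4 • x = 0 := fun x =>
    AddSubgroup.torsionBy.nsmul_iff (n := 4)
  have hmem2 : ∀ x : A, x ∈ AddSubgroup.torsionBy A 2 ↔ 2 • x = 0 := fun x =>
    AddSubgroup.torsionBy.nsmul_iff (n := 2)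
  -- its range is `A[4]`
  have hrange : f.range = AddSubgroup.torsionBy A 4 := by
    ext y
    rw [AddMonoidHom.mem_range, hmem4]
    constructor
    · rintro ⟨x, rfl⟩
      rw [hf, smul_smul]
      have e8 : (4 * 2) • (x : A) = 8 • (x : A) := by norm_num
      rw [e8]
      exact (hmem8 x).1 x.2
    · intro hy
      obtain ⟨x, rfl⟩ := hdiv y hy
      have hx8 : 8 • x = 0 := by
        have e8 : (4 * 2) • x = 8 • x := by norm_num
        rw [← e8, ← smul_smul]; exact hy
      exact ⟨⟨x, (hmem8 x).2 hx8⟩, rfl⟩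
  -- its kernel is `A[2]` seen inside `A[8]`
  have hle : AddSubgroup.torsionBy A 2 ≤ AddSubgroup.torsionBy A 8 := by
    intro x hx
    rw [hmem2] at hx
    rw [hmem8]
    have e8 : (4 * 2) • x = 8 • x := by norm_num
    rw [← e8, ← smul_smul, hx, smul_zero]
  have hker : f.ker = (AddSubgroup.torsionBy A 2).addSubgroupOf (AddSubgroup.torsionBy A 8) := by
    ext x
    rw [AddMonoidHom.mem_ker, AddSubgroup.mem_addSubgroupOf, hmem2, hf]
  have hcker : Nat.card f.ker = n := by
    rw [hker, Nat.card_congr (AddSubgroup.addSubgroupOfEquivOfLe hle).toEquiv, h2]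
  have hcrange : Nat.card f.range = m := by rw [hrange, h4]
  have hmul := f.ker.card_mul_index
  rw [AddSubgroup.index_ker, hcker, hcrange] at hmul
  exact hmul.symm

end Algebra

variable (W : WeierstrassCurve ℚ) [W.IsElliptic] [W.IsGloballyMinimal]

/-- Arithmetic side condition `4 ∣ 2·2` for `[2]_* : Sel^(4) → Sel^(2)` (content-free private
helper). [folklore] -/
private theorem four_dvd₃ : (4 : ℤ) ∣ 2 * 2 := by norm_num

/-- Arithmetic side condition `8 ∣ 4·2` for `[2]_* : Sel^(8) → Sel^(4)` (content-free private
helper). [folklore] -/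
private theorem eight_dvd₃ : (8 : ℤ) ∣ 4 * 2 := by norm_num

/-- Arithmetic side condition `16 ∣ 8·2` for `[2]_* : Sel^(16) → Sel^(8)` (content-free private
helper). [folklore] -/
private theorem sixteen_dvd₃ : (16 : ℤ) ∣ 8 * 2 := by norm_num

omit [W.IsElliptic] [W.IsGloballyMinimal] in
/-- **Every 4-Selmer class lifts to an 8-Selmer class ⟹ `Ш[4] ⊆ 2Ш`** (`Sel^(4) ↠ Ш[4]`,
`π₄([2]_* z) = 2·π₈(z)`) — the reading of "every Ш-type 4-covering has an everywhere-locally-soluble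
8-covering above it" (engine H NONEMPTY / engine G `m = 0` on the `#Ш_an = 64` rows).
[cite: Cassels1998, §1; SilvermanAEC2009, Thm. X.4.2(a)] -/
theorem X5.four_torsion_two_divisible_of_selmer_lift₄
    (hF : ∀ s : W.selmerGroup 4, ∃ z : W.selmerGroup 8, W.selmerZSMul 2 eight_dvd₃ z = s) :
    ∀ y : W.sha, 4 • y = 0 → ∃ x : W.sha, 2 • x = y := by
  intro y hy
  obtain ⟨s, rfl⟩ := W.exists_selmerToSha_eq (n := 4) (by norm_num) y (by rw [ofNat_zsmul]; exact hy)
  obtain ⟨z, rfl⟩ := hF s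
  exact ⟨W.selmerToSha 8 z, by rw [selmerToSha_selmerZSMul, ofNat_zsmul]⟩

omit [W.IsElliptic] [W.IsGloballyMinimal] in
/-- **Mode S at levels `8 | 16`: `Ш[16] = Ш[8]` from the Selmer groups.** If no `s ∈ Sel^(8)(E/ℚ)`
with `4·π₈(s) ≠ 0` is `[2]_* z` for a `z ∈ Sel^(16)(E/ℚ)`, then every `x ∈ Ш[16]` has `8·x = 0`
(`Sel^(16) ↠ Ш[16]` and `π₈([2]_* z) = 2·π₁₆(z)`). This is the input NO engine of the lane computes
(a 16-descent / the Cassels–Tate pairing on `Sel^(8) × Sel^(2)`). [cite: Cassels1998, §1; Stamminger2005, Thm. 6.2.2] -/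
theorem X5.stable_eight_of_selmer_modeS₈
    (hS : ∀ s : W.selmerGroup 8, 4 • W.selmerToSha 8 s ≠ 0 →
      ¬ ∃ z : W.selmerGroup 16, W.selmerZSMul 2 sixteen_dvd₃ z = s) :
    ∀ x : W.sha, 16 • x = 0 → 8 • x = 0 := by
  intro x hx
  by_contra h8
  obtain ⟨z, rfl⟩ := W.exists_selmerToSha_eq (n := 16) (by norm_num) x (by rw [ofNat_zsmul]; exact hx)
  refine hS (W.selmerZSMul 2 sixteen_dvd₃ z) ?_ ⟨z, rfl⟩
  rw [selmerToSha_selmerZSMul, ofNat_zsmul, smul_smul]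
  have e : (4 * 2) • W.selmerToSha 16 z = 8 • W.selmerToSha 16 z := by norm_num
  rw [e]
  exact h8

omit [W.IsElliptic] [W.IsGloballyMinimal] in
/-- **The level-3 datum** from `Ш[16] = Ш[8]`, `#Ш[8] = 2^m` and `ord₂ #Ш_an = m`.
[cite: SilvermanAEC2009, Thm. X.4.2(a)] -/
theorem X5.descentCertificateAt_of_level_three (hstab : ∀ x : W.sha, 16 • x = 0 → 8 • x = 0)
    {m : ℕ} (hcard : Nat.card (AddSubgroup.torsionBy W.sha 8) = 2 ^ m)
    {q : ℚ} (hq : shaAn W = (q : ℂ)) (hv : padicValRat 2 q = m) : X5.DescentCertificateAt W := by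
  refine X5.descentCertificateAt_of_level W (k := 3) (m := m) (fun x hx => ?_) (by simpa using hcard) hq hv
  have h16 : 16 • x = 0 := by simpa using hx
  simpa using hstab x h16

/-- **The lower-bound-only rows, typed: `BSD(E, 2)` from the level-3 datum over the Selmer groups**
(granted GZK; nothing is claimed for any curve — `hS` is the OPEN input): analytic rank `≤ 1`;
`#E(ℚ)[2] = 2^t`, `#Sel^(2)(E/ℚ) = 2^(r_an+t+2)` (`#Ш[2] = 4`); every 2-Selmer class lifts to `Sel^(4)`
(`Ш[2] ⊆ 2Ш`, `#Ш[4] = 16`); every 4-Selmer class lifts to `Sel^(8)` (`Ш[4] ⊆ 2Ш`, `#Ш[8] = 64`);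
mode S at levels `8 | 16` (`Ш[16] = Ш[8]`); `ord₂ #Ш_an = 6`. [cite: SilvermanAEC2009, Thm. X.4.2(a); Cassels1998, §1; MerrimanSiksekSmart1996, §4; Stamminger2005, Thm. 6.2.2] -/
theorem X5.bsdp_two_of_selmer_level3 (hGZK : rank_eq_analyticRank_of_analyticRank_le_one)
    (hr : W.analyticRank ≤ 1) {t : ℕ}
    (ht : Nat.card (AddSubgroup.torsionBy W.toAffine.Point 2) = 2 ^ t)
    (hSel : Nat.card (W.selmerGroup 2) = 2 ^ (W.analyticRank + t + 2))
    (hF : ∀ s : W.selmerGroup 2, ∃ z : W.selmerGroup 4, W.selmerZSMul 2 four_dvd₃ z = s)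
    (hF₄ : ∀ s : W.selmerGroup 4, ∃ z : W.selmerGroup 8, W.selmerZSMul 2 eight_dvd₃ z = s)
    (hS : ∀ s : W.selmerGroup 8, 4 • W.selmerToSha 8 s ≠ 0 →
      ¬ ∃ z : W.selmerGroup 16, W.selmerZSMul 2 sixteen_dvd₃ z = s)
    {q : ℚ} (hq : shaAn W = (q : ℂ)) (hv : padicValRat 2 q = 6) : BSDp W 2 := by
  have h2 := X5.card_sha_two_of_card_selmerTwo W (hGZK W hr).1 ht hSel
  have hdiv := X5.two_divisible_of_selmer_lift W hF
  have h4 := X5.card_sha_four_eq_sixteen W h2 hdiv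
  have hdiv₄ := X5.four_torsion_two_divisible_of_selmer_lift₄ W hF₄
  have h8 : Nat.card (AddSubgroup.torsionBy W.sha 8) = 2 ^ 6 := by
    rw [card_torsionBy_eight_of_two_divisible_four h2 h4 hdiv₄]; norm_num
  exact X5.bsdp_two_of_descentCertificateAt W hGZK hr
    (X5.descentCertificateAt_of_level_three W (X5.stable_eight_of_selmer_modeS₈ W hS) h8 hq
      (by exact_mod_cast hv))

end Literature.NumberTheory.EllipticCurves.Rank1Residual.Typed

end
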